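import Literature.NumberTheory.Transcendental.KZProductIdeal
import Literature.NumberTheory.Transcendental.KZLogCalculusProofs

/-!
# `NormalFormPrinciple` (stmt-KontsevichZagierPeriods-3869), line `SketchIdeator1` — stub `stub_signKernelSplit`

The **sign-kernel split**, the hinge of the line "π buys geometry". For a polynomial `Q` over `ℚ`
in `n` variables, a set `D ⊆ ℝⁿ` and a function `g`, consider the representations (last
coordinate `u ∈ [0, 1]`, `x = init z`)

* `ρ  = [{x ∈ D, Q x ≠ 0} × [0,1], g(x) · Q(x)/(Q(x)²(1−u)² + u²)]`,
* `ρp = [{x ∈ D, Q x > 0} × [0,1], g(x)/((1−u)² + u²)]`,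
* `ρm = [{x ∈ D, Q x < 0} × [0,1], g(x)/((1−u)² + u²)]`.

Then `[ρ] − [ρp] + [ρm]` is a relation of the Kontsevich–Zagier calculus (`KZ.relations`):

1. domain additivity (rule 1a) along the sign of `Q`: `[ρ] ≡ [ρ₊] + [ρ₋]`, the restrictions of
   `ρ` to `{Q > 0}` and `{Q < 0}` (disjoint bands);
2. on the positive half the fibrewise Möbius substitution `w = u/(u + (1−u) Q(x))` of `[0,1]`
   onto itself is ONE change-of-variables move (rule 2): it is `ℚ`-semialgebraic (a rational map),
   injective, differentiable with block-triangular derivative of determinant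
   `Q/(u + (1−u)Q)² > 0` (`LinearMap.det_of_snoc_init`), and
   `(1−w)² + w² = ((1−u)²Q² + u²)/(u + (1−u)Q)²`, so that
   `g/((1−w)²+w²) · Q/(u+(1−u)Q)² = g · Q/(Q²(1−u)²+u²)`; hence `[ρ₊] ≡ [ρp]`;
3. on the negative half `[ρ₋] ≡ −[ρ₋.neg]` (`[σ, −f] ≡ −[σ, f]`, rule 1b), and `ρ₋.neg` has
   integrand `g · (−Q)/((−Q)²(1−u)²+u²)`, so the same substitution with `−Q` gives
   `[ρ₋.neg] ≡ [ρm]`.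

(On each fibre `∫₀¹ Q du/(Q²(1−u)²+u²) = (π/2)·sgn Q`: one strict inequality of the domain is
sold for one rational factor at the price of one `[π]`.) Sources: M. Kontsevich, D. Zagier,
*Periods* (2001), §1.1 (the `π` examples) and §1.2 (rules 1)–2)); the derivation inside the fixed
calculus `KZCalculus.lean` is this project's (pattern of `KZ.of_sub_of_mem_relations_of_affine`).
-/

noncomputable section

open MeasureTheory Set
open Literature.NumberTheory.Transcendental Literature.NumberTheory.Transcendental.KZ
open Literature.ModelTheory.ExponentialFields (IsSemialgebraic)

namespace Summit.KontsevichZagierPeriods.HurwitzMicroSectors.NormalFormPrinciple.PiBox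

namespace stub_signKernelSplitAux

/-! ### Scalar facts about the Möbius substitution `w = u/(u + (1 - u) q)` -/

/-- The denominator `u + (1 - u) q` is positive for `u ∈ [0,1]`, `q > 0`. [folklore] -/
theorem den_pos {u q : ℝ} (hu0 : 0 ≤ u) (hu1 : u ≤ 1) (hq : 0 < q) : 0 < u + (1 - u) * q := by
  have h1 : 0 ≤ (1 - u) * q := mul_nonneg (by linarith) hq.le
  rcases hu0.lt_or_eq with h | h
  · linarith
  · subst h
    linarith

/-- The kernel identity behind the substitution `w = u/(u + (1-u) q)`:
`1/((1−w)² + w²) · q/(u + (1−u)q)² = q/(q²(1−u)² + u²)`. [folklore] -/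
theorem kernel_identity {u q : ℝ} (hD : u + (1 - u) * q ≠ 0) :
    1 / ((1 - u / (u + (1 - u) * q)) ^ 2 + (u / (u + (1 - u) * q)) ^ 2) *
        (q / (u + (1 - u) * q) ^ 2) = q / (q ^ 2 * (1 - u) ^ 2 + u ^ 2) := by
  have h1 : 1 - u / (u + (1 - u) * q) = (1 - u) * q / (u + (1 - u) * q) := by
    field_simp
    ring
  rw [h1, div_pow, div_pow, ← add_div, one_div_div, div_mul_div_comm, mul_comm (_ ^ 2) q,
    mul_div_mul_right _ _ (pow_ne_zero 2 hD)]
  congr 1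
  ring

/-- The substitution maps `[0,1]` into `[0,1]`. [folklore] -/
theorem moebius_mem {u q : ℝ} (hu0 : 0 ≤ u) (hu1 : u ≤ 1) (hq : 0 < q) :
    0 ≤ u / (u + (1 - u) * q) ∧ u / (u + (1 - u) * q) ≤ 1 := by
  have hD := den_pos hu0 hu1 hq
  refine ⟨div_nonneg hu0 hD.le, (div_le_one hD).2 ?_⟩
  nlinarith [mul_nonneg (sub_nonneg.2 hu1) hq.le]

/-- The substitution is injective on `[0,1]`. [folklore] -/
theorem moebius_inj {u v q : ℝ} (hu0 : 0 ≤ u) (hu1 : u ≤ 1) (hv0 : 0 ≤ v) (hv1 : v ≤ 1)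
    (hq : 0 < q) (h : u / (u + (1 - u) * q) = v / (v + (1 - v) * q)) : u = v := by
  rw [div_eq_div_iff (den_pos hu0 hu1 hq).ne' (den_pos hv0 hv1 hq).ne'] at h
  have h2 : (u - v) * q = 0 := by linear_combination h
  rcases mul_eq_zero.1 h2 with h3 | h3
  · linarith
  · exact absurd h3 hq.ne'

/-- The substitution maps `[0,1]` onto `[0,1]` (inverse `u = w q/(w q + 1 − w)`). [folklore] -/
theorem moebius_surj {w q : ℝ} (hw0 : 0 ≤ w) (hw1 : w ≤ 1) (hq : 0 < q) :
    ∃ u : ℝ, 0 ≤ u ∧ u ≤ 1 ∧ u / (u + (1 - u) * q) = w := by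
  have hE : 0 < w * q + (1 - w) := by
    have := den_pos (sub_nonneg.2 hw1) (by linarith : 1 - w ≤ 1) hq
    linarith
  refine ⟨w * q / (w * q + (1 - w)), div_nonneg (mul_nonneg hw0 hq.le) hE.le,
    (div_le_one hE).2 (by linarith), ?_⟩
  have h1 : w * q / (w * q + (1 - w)) + (1 - w * q / (w * q + (1 - w))) * q =
      q / (w * q + (1 - w)) := by
    field_simp
    ring
  rw [h1, div_div_div_cancel_right₀ hE.ne', mul_div_assoc, div_self hq.ne', mul_one]

/-! ### The fibrewise Möbius substitution is a change-of-variables move -/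

/-- **The fibrewise Möbius substitution.** Over a base `S ⊆ ℝⁿ` on which the polynomial `Q` is
positive, the representations `r = [S × [0,1], G(x) · Q/(Q²(1−u)² + u²)]` and
`r' = [S × [0,1], G(x)/((1−u)² + u²)]` differ by ONE change-of-variables move (Kontsevich–Zagier's
rule 2)) along `Φ (x, u) = (x, u/(u + (1−u) Q(x)))`: `Φ` is `ℚ`-semialgebraic (rational), maps the
band onto itself injectively, and is differentiable with block-triangular derivative of
determinant `Q/(u + (1−u)Q)² > 0` (`LinearMap.det_of_snoc_init`); the integrands match by
`kernel_identity`. [cite: KontsevichZagier2001, §1.2] -/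
theorem of_sub_of_mem_relations_moebius {n : ℕ} (S : Set (Fin n → ℝ)) (G : (Fin n → ℝ) → ℝ)
    (Q : MvPolynomial (Fin n) ℚ) (hS : ∀ x ∈ S, 0 < MvPolynomial.aeval x Q)
    (r r' : IntegralRep (n + 1))
    (hr : r.domain = KZlog.band S (fun _ => 0) (fun _ => 1))
    (hr' : r'.domain = KZlog.band S (fun _ => 0) (fun _ => 1))
    (hri : ∀ z ∈ r.domain, r.integrand z = G (Fin.init z) *
        (MvPolynomial.aeval (Fin.init z) Q /
          ((MvPolynomial.aeval (Fin.init z) Q) ^ 2 * (1 - z (Fin.last n)) ^ 2 + z (Fin.last n) ^ 2)))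
    (hr'i : ∀ z ∈ r'.domain, r'.integrand z = G (Fin.init z) *
        (1 / ((1 - z (Fin.last n)) ^ 2 + z (Fin.last n) ^ 2))) :
    of r - of r' ∈ relations := by
  -- the polynomial as a function on the base; restate the data in terms of it
  set qQ : (Fin n → ℝ) → ℝ := fun x => MvPolynomial.aeval x Q with hqQ
  have hS' : ∀ x ∈ S, 0 < qQ x := hS
  have hri' : ∀ z ∈ r.domain, r.integrand z = G (Fin.init z) *
      (qQ (Fin.init z) /
        (qQ (Fin.init z) ^ 2 * (1 - z (Fin.last n)) ^ 2 + z (Fin.last n) ^ 2)) := hri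
  have hqd : ∀ x, HasFDerivAt qQ (fderiv ℝ qQ x) x := fun x =>
    ((Literature.ModelTheory.ExponentialFields.analyticOnNhd_aeval Q) x
      trivial).differentiableAt.hasFDerivAt
  have hP : ∀ z : Fin (n + 1) → ℝ,
      MvPolynomial.aeval z (MvPolynomial.rename Fin.castSucc Q) = qQ (Fin.init z) := fun z => by
    rw [MvPolynomial.aeval_rename]
    rfl
  -- on the band: `x ∈ S`, `0 ≤ u ≤ 1`, `0 < q`, `0 < u + (1 - u) q`
  have hmem : ∀ z ∈ r.domain, Fin.init z ∈ S ∧ 0 ≤ z (Fin.last n) ∧ z (Fin.last n) ≤ 1 :=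
    fun z hz => by
    rw [hr] at hz
    simpa [KZlog.mem_band] using hz
  have hq : ∀ z ∈ r.domain, 0 < qQ (Fin.init z) := fun z hz => hS' _ (hmem z hz).1
  have hD : ∀ z ∈ r.domain, 0 < z (Fin.last n) + (1 - z (Fin.last n)) * qQ (Fin.init z) :=
    fun z hz => den_pos (hmem z hz).2.1 (hmem z hz).2.2 (hq z hz)
  -- the substitution
  set Φ : (Fin (n + 1) → ℝ) → (Fin (n + 1) → ℝ) := fun z =>
    Fin.snoc (Fin.init z)
      (z (Fin.last n) / (z (Fin.last n) + (1 - z (Fin.last n)) * qQ (Fin.init z))) with hΦ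
  have hΦinit : ∀ z, Fin.init (Φ z) = Fin.init z := fun z => by simp [hΦ]
  have hΦlast : ∀ z, Φ z (Fin.last n) =
      z (Fin.last n) / (z (Fin.last n) + (1 - z (Fin.last n)) * qQ (Fin.init z)) := fun z => by
    simp [hΦ]
  have hmaps : ∀ z ∈ r.domain, Φ z ∈ r'.domain := by
    intro z hz
    rw [hr', KZlog.mem_band, hΦinit, hΦlast]
    exact ⟨(hmem z hz).1, moebius_mem (hmem z hz).2.1 (hmem z hz).2.2 (hq z hz)⟩
  -- continuous linear pieces and the derivative
  let initL : (Fin (n + 1) → ℝ) →L[ℝ] (Fin n → ℝ) :=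
    ContinuousLinearMap.pi fun i => ContinuousLinearMap.proj (Fin.castSucc i)
  let lastL : (Fin (n + 1) → ℝ) →L[ℝ] ℝ := ContinuousLinearMap.proj (Fin.last n)
  have hinitL : ∀ w, initL w = Fin.init w := fun w => rfl
  have hlastL : ∀ w, lastL w = w (Fin.last n) := fun w => rfl
  let row : (Fin (n + 1) → ℝ) → (Fin (n + 1) → ℝ) →L[ℝ] ℝ := fun z =>
    (-(z (Fin.last n) * (1 - z (Fin.last n))) /
        (z (Fin.last n) + (1 - z (Fin.last n)) * qQ (Fin.init z)) ^ 2) •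
      (fderiv ℝ qQ (Fin.init z)).comp initL +
    (qQ (Fin.init z) / (z (Fin.last n) + (1 - z (Fin.last n)) * qQ (Fin.init z)) ^ 2) • lastL
  have hrow : ∀ z w, row z w = (-(z (Fin.last n) * (1 - z (Fin.last n))) /
        (z (Fin.last n) + (1 - z (Fin.last n)) * qQ (Fin.init z)) ^ 2) *
          fderiv ℝ qQ (Fin.init z) (Fin.init w) +
      (qQ (Fin.init z) / (z (Fin.last n) + (1 - z (Fin.last n)) * qQ (Fin.init z)) ^ 2) *
        w (Fin.last n) := by
    intro z w
    simp [row, hinitL, hlastL]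
  let Φ' : (Fin (n + 1) → ℝ) → (Fin (n + 1) → ℝ) →L[ℝ] (Fin (n + 1) → ℝ) := fun z =>
    ContinuousLinearMap.pi
      (Fin.lastCases (motive := fun _ => (Fin (n + 1) → ℝ) →L[ℝ] ℝ) (row z)
        (fun i => ContinuousLinearMap.proj (Fin.castSucc i)))
  have hΦ' : ∀ z w, Φ' z w = Fin.snoc (Fin.init w) (row z w) := by
    intro z w
    funext i
    refine Fin.lastCases ?_ (fun j => ?_) i
    · simp [Φ']
    · simp [Φ', Fin.init]
  -- determinant
  have hdet : ∀ z, (Φ' z).det =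
      qQ (Fin.init z) / (z (Fin.last n) + (1 - z (Fin.last n)) * qQ (Fin.init z)) ^ 2 := by
    intro z
    have h := LinearMap.det_of_snoc_init (Φ' z : (Fin (n + 1) → ℝ) →ₗ[ℝ] (Fin (n + 1) → ℝ))
      LinearMap.id
      (((-(z (Fin.last n) * (1 - z (Fin.last n))) /
          (z (Fin.last n) + (1 - z (Fin.last n)) * qQ (Fin.init z)) ^ 2) •
        (fderiv ℝ qQ (Fin.init z) : (Fin n → ℝ) →L[ℝ] ℝ)) : (Fin n → ℝ) →ₗ[ℝ] ℝ)
      (qQ (Fin.init z) / (z (Fin.last n) + (1 - z (Fin.last n)) * qQ (Fin.init z)) ^ 2)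
      (fun w => by
        rw [ContinuousLinearMap.coe_coe, hΦ', hrow]
        simp)
    rw [LinearMap.det_id, mul_one] at h
    exact h
  -- derivative (on the band the denominator is positive)
  have hderiv : ∀ z ∈ r.domain, HasFDerivAt Φ (Φ' z) z := by
    intro z hz
    have hDz := (hD z hz).ne'
    rw [hasFDerivAt_pi']
    intro i
    refine Fin.lastCases ?_ (fun j => ?_) i
    · have h1 : HasFDerivAt (fun x : Fin (n + 1) → ℝ => Fin.init x) initL z := initL.hasFDerivAt
      have hqc := (hqd _).comp z h1
      have hl : HasFDerivAt (fun x : Fin (n + 1) → ℝ => x (Fin.last n)) lastL z :=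
        hasFDerivAt_apply (Fin.last n) z
      have hden := hl.fun_add (((hasFDerivAt_const (1 : ℝ) z).fun_sub hl).fun_mul hqc)
      have hinv := (hasDerivAt_inv hDz).comp_hasFDerivAt z hden
      have h := hl.fun_mul hinv
      have hfun : (fun x => Φ x (Fin.last n)) =
          fun x => x (Fin.last n) * ((fun y : ℝ => y⁻¹) ∘ fun x : Fin (n + 1) → ℝ =>
            x (Fin.last n) + (1 - x (Fin.last n)) * (qQ ∘ fun x : Fin (n + 1) → ℝ =>
              Fin.init x) x) x := by
        funext x
        simp [hΦ, div_eq_mul_inv]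
      show HasFDerivAt (fun x => Φ x (Fin.last n)) _ z
      rw [hfun]
      refine h.congr_fderiv (ContinuousLinearMap.ext fun w => ?_)
      simp only [ContinuousLinearMap.coe_comp, Function.comp_apply, hΦ']
      simp [hinitL, hlastL, hrow]
      field_simp
      ring
    · have hfun : (fun x => Φ x (Fin.castSucc j)) = fun x => x (Fin.castSucc j) := by
        funext x
        simp [hΦ, Fin.init]
      show HasFDerivAt (fun x => Φ x (Fin.castSucc j)) _ z
      rw [hfun]
      refine (hasFDerivAt_apply (Fin.castSucc j) z).congr_fderiv
        (ContinuousLinearMap.ext fun w => ?_)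
      simp [hΦ', Fin.init]
  refine changeOfVariablesRel_subset_relations ⟨n + 1, r, r', Φ, Φ', ?_, ?_, ?_, ?_, ?_, rfl⟩
  · -- `Φ` is a `ℚ`-semialgebraic (rational) map
    refine IsSemialgebraicMapOn.of_forall r.isSemialgebraic_domain fun i => ?_
    refine Fin.lastCases ?_ (fun j => ?_) i
    · have hsa := isSemialgebraicFunOn_aeval_div_aeval r.isSemialgebraic_domain
        (MvPolynomial.X (Fin.last n))
        (MvPolynomial.X (Fin.last n) +
          (1 - MvPolynomial.X (Fin.last n)) * MvPolynomial.rename Fin.castSucc Q)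
        (fun z hz => by
          simp only [map_add, map_mul, map_sub, map_one, MvPolynomial.aeval_X, hP]
          exact (hD z hz).ne')
      refine hsa.congr fun z _ => ?_
      simp only [map_add, map_mul, map_sub, map_one, MvPolynomial.aeval_X, hP, hΦlast]
    · exact (isSemialgebraicFunOn_apply r.isSemialgebraic_domain (Fin.castSucc j)).congr
        fun z _ => by simp [hΦ, Fin.init]
  · exact fun z hz => (hderiv z hz).hasFDerivWithinAt
  · -- injective
    intro z₁ hz₁ z₂ hz₂ h
    have hy : Fin.init z₁ = Fin.init z₂ := by
      have := congrArg Fin.init h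
      rwa [hΦinit, hΦinit] at this
    have hl : z₁ (Fin.last n) = z₂ (Fin.last n) := by
      have := congrFun h (Fin.last n)
      rw [hΦlast, hΦlast, hy] at this
      exact moebius_inj (hmem z₁ hz₁).2.1 (hmem z₁ hz₁).2.2 (hmem z₂ hz₂).2.1 (hmem z₂ hz₂).2.2
        (hq z₂ hz₂) this
    rw [← Fin.snoc_init_self z₁, ← Fin.snoc_init_self z₂, hy, hl]
  · -- the image is the band again
    ext w
    constructor
    · intro hw
      rw [hr', KZlog.mem_band] at hw
      obtain ⟨hy, hw0, hw1⟩ := hw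
      obtain ⟨u, hu0, hu1, hu⟩ := moebius_surj hw0 hw1 (hS' _ hy)
      refine ⟨Fin.snoc (Fin.init w) u, ?_, ?_⟩
      · rw [hr, KZlog.snoc_mem_band]
        exact ⟨hy, hu0, hu1⟩
      · simp only [hΦ, Fin.init_snoc, Fin.snoc_last]
        rw [hu, Fin.snoc_init_self]
    · rintro ⟨z, hz, rfl⟩
      exact hmaps z hz
  · -- the integrands
    intro z hz
    have hzD := hD z hz
    rw [hri' z hz, hr'i _ (hmaps z hz), hdet, hΦinit, hΦlast,
      abs_of_pos (div_pos (hq z hz) (pow_pos hzD 2)), mul_assoc, kernel_identity hzD.ne']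

end stub_signKernelSplitAux

open stub_signKernelSplitAux in
/-- **Sign-kernel split** (the hinge of the line): with `ρ = [{x ∈ D, Q ≠ 0} × [0,1], g·Q/(Q²(1−u)²+u²)]`,
`ρp = [{x ∈ D, Q > 0} × [0,1], g/((1−u)²+u²)]`, `ρm = [{x ∈ D, Q < 0} × [0,1], g/((1−u)²+u²)]`:
`[ρ] − [ρp] + [ρm] ∈ relations` — domain additivity along the sign of `Q` (rule 1a)) and, on each
half, the fibrewise substitution `w = u/(u + (1−u)·|Q(x)|)` of `[0,1]` onto itself (rule 2); it is
`ℚ`-semialgebraic, injective, with block-triangular derivative of determinant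
`|Q|/(u + (1−u)|Q|)² > 0`, and `(1−w)² + w² = ((1−u)²Q² + u²)/(u + (1−u)|Q|)²`), the negative half
through `[σ, −f] ≡ −[σ, f]`. [cite: KontsevichZagier2001, §1.2] -/
theorem stub_signKernelSplit :
    ∀ (n : ℕ) (D : Set (Fin n → ℝ)) (g : (Fin n → ℝ) → ℝ) (Q : MvPolynomial (Fin n) ℚ)
      (ρ ρp ρm : IntegralRep (n + 1)),
    ρ.domain = KZlog.band {x | x ∈ D ∧ MvPolynomial.aeval x Q ≠ 0} (fun _ => 0) (fun _ => 1) →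
    (∀ z ∈ ρ.domain, ρ.integrand z = g (Fin.init z) *
        (MvPolynomial.aeval (Fin.init z) Q /
          ((MvPolynomial.aeval (Fin.init z) Q) ^ 2 * (1 - z (Fin.last n)) ^ 2 + z (Fin.last n) ^ 2))) →
    ρp.domain = KZlog.band {x | x ∈ D ∧ 0 < MvPolynomial.aeval x Q} (fun _ => 0) (fun _ => 1) →
    (∀ z ∈ ρp.domain, ρp.integrand z = g (Fin.init z) *
        (1 / ((1 - z (Fin.last n)) ^ 2 + z (Fin.last n) ^ 2))) →
    ρm.domain = KZlog.band {x | x ∈ D ∧ MvPolynomial.aeval x Q < 0} (fun _ => 0) (fun _ => 1) →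
    (∀ z ∈ ρm.domain, ρm.integrand z = g (Fin.init z) *
        (1 / ((1 - z (Fin.last n)) ^ 2 + z (Fin.last n) ^ 2))) →
    of ρ - of ρp + of ρm ∈ relations := by
  intro n D g Q ρ ρp ρm hρd hρi hρpd hρpi hρmd hρmi
  -- the two halves of `ρ.domain`
  have hpsub : ρp.domain ⊆ ρ.domain := by
    rw [hρpd, hρd]
    rintro z ⟨⟨hx, hQ⟩, hu⟩
    exact ⟨⟨hx, hQ.ne'⟩, hu⟩
  have hmsub : ρm.domain ⊆ ρ.domain := by
    rw [hρmd, hρd]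
    rintro z ⟨⟨hx, hQ⟩, hu⟩
    exact ⟨⟨hx, hQ.ne⟩, hu⟩
  obtain ⟨σp, hσpd, hσpi⟩ : ∃ σp : IntegralRep (n + 1), σp.domain = ρp.domain ∧
      σp.integrand = ρ.integrand :=
    ⟨ρ.restrict ρp.domain ρp.isSemialgebraic_domain hpsub, rfl, rfl⟩
  obtain ⟨σm, hσmd, hσmi⟩ : ∃ σm : IntegralRep (n + 1), σm.domain = ρm.domain ∧
      σm.integrand = ρ.integrand :=
    ⟨ρ.restrict ρm.domain ρm.isSemialgebraic_domain hmsub, rfl, rfl⟩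
  obtain ⟨σn, hnd, hni⟩ : ∃ σn : IntegralRep (n + 1), σn.domain = ρm.domain ∧
      σn.integrand = -σm.integrand :=
    ⟨σm.neg, hσmd, rfl⟩
  -- rule 1a): splitting `ρ` along the sign of `Q`
  have hsplit : of ρ - of σp - of σm ∈ relations := by
    refine domainAddRel_subset_relations ⟨n + 1, ρ, σp, σm, ?_, ?_, fun z _ => by rw [hσpi],
      fun z _ => by rw [hσmi], rfl⟩
    · rw [hσpd, hσmd, hρd, hρpd, hρmd, ← band_union]
      congr 1
      ext x
      simp only [mem_setOf_eq, mem_union]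
      constructor
      · rintro ⟨hx, hQ⟩
        rcases lt_or_gt_of_ne hQ with h | h
        · exact Or.inr ⟨hx, h⟩
        · exact Or.inl ⟨hx, h⟩
      · rintro (⟨hx, h⟩ | ⟨hx, h⟩)
        · exact ⟨hx, h.ne'⟩
        · exact ⟨hx, h.ne⟩
    · have : σp.domain ∩ σm.domain = ∅ := by
        rw [hσpd, hσmd, hρpd, hρmd]
        refine band_inter_band_eq_empty ?_
        ext x
        simp only [mem_inter_iff, mem_setOf_eq, mem_empty_iff_false, iff_false, not_and, not_lt,
          and_imp]
        exact fun _ h _ => h.le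
      rw [this, measure_empty]
  -- rule 2) on the positive half
  have hpos : of σp - of ρp ∈ relations :=
    of_sub_of_mem_relations_moebius {x | x ∈ D ∧ 0 < MvPolynomial.aeval x Q} g Q
      (fun x hx => hx.2) σp ρp (hσpd.trans hρpd) hρpd
      (fun z hz => by rw [hσpi]; exact hρi z (hpsub (hσpd ▸ hz))) hρpi
  -- the negative half through `[σ, -f] ≡ -[σ, f]`, then rule 2) with `-Q`
  have hneg₁ : of σm + of σn ∈ relations :=
    of_add_of_mem_relations_of_eqOn_neg (hnd.trans hσmd.symm) fun z _ => by rw [hni]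
  have hneg₂ : of σn - of ρm ∈ relations := by
    refine of_sub_of_mem_relations_moebius {x | x ∈ D ∧ MvPolynomial.aeval x Q < 0} g (-Q)
      (fun x hx => by simpa using hx.2) σn ρm (hnd.trans hρmd) hρmd (fun z hz => ?_) hρmi
    rw [hni, Pi.neg_apply, hσmi, hρi z (hmsub (hnd ▸ hz)), map_neg, neg_sq]
    ring
  have : of ρ - of ρp + of ρm =
      (of ρ - of σp - of σm) + (of σp - of ρp) + (of σm + of σn) - (of σn - of ρm) := by abel
  rw [this]
  exact relations.sub_mem (relations.add_mem (relations.add_mem hsplit hpos) hneg₁) hneg₂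

end Summit.KontsevichZagierPeriods.HurwitzMicroSectors.NormalFormPrinciple.PiBox
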